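import Literature.Computability.Complexity.ParallelRepetitionExpanding
import Literature.Computability.Complexity.AffinePlane
import HarnessLib

/-!
# The projection game of a regular constraint graph: completeness, soundness, expansion, repetition

Topic `Computability/Complexity`, namespace `Literature.Computability.Complexity.Expander.RotGraph`.
The base case of the tree's proof of the NP-hardness of gap label cover for every constant
soundness error (Arora–Barak 2009, Thm. 22.15; Dinur–Steurer 2014, §3.3), in the format in which
Dinur's gap amplification hands over its instances (`RegularWalks.lean`, `Expanderize.lean`,
`PoweringSoundness.lean`): a `d`-regular rotation graph `G : RotGraph n d` with a constraint
`C v i : ℕ → ℕ → Bool` on every dart `(v, i)` over the alphabet `[W]`, soundness measured by the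
number of darts violated by an assignment `σ : Fin n → ℕ` with values `< W`.

* `dartGame G C W dec hd` — **the projection game of `(G, C)`** (Arora–Barak 2009, Claim 22.36 with
  `q = 2`, which has the projection property, Exercise 22.9): Bob's vertices are the `n d` darts
  `δ = (v, i)`, with labels `b : β` DECODED into pairs `dec δ b = (a, b) ∈ [W]²` ("`y_i` holds the
  restriction of the assignment to the variables used by the `i`th constraint"; the decoding is a
  parameter so that both the plain alphabet `[W]²`, `dec = id`, and the aliased alphabet `[W²]` of
  `aliasDec` — every label decodes to an ACCEPTING pair when the dart has one, which makes the
  projections total, as the list format of `LabelCover.lean` requires — are instances); Alice's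
  vertices are the `n` vertices of `G`, labelled by `[W]`; every dart carries two unit-weight edges,
  to its tail `v` (`s = 0`) and to its head `nbr v i` (`s = 1`), whose projection sends a label
  decoding to `(a, b)` to `a`, resp. `b`, if `C v i a b` holds and to nothing otherwise.  It is
  bi-regular: Bob degree `2`, Alice degree `2d` (`wV_dartGame`, `wU_dartGame`), total weight `2 n d`
  (`total_dartGame`); a `ProjGame` in the sense of `ProjectionGames.lean`.
* `dartGame_sat` — **completeness**: if `dec` reaches every accepting pair, an assignment with values
  `< W` satisfying every dart constraint yields strategies satisfying every edge ("Clearly, if `φ` is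
  satisfiable, then so is `ψ`"); `accPairs`, `aliasDec`, `exists_aliasDec_eq` — the canonical list of
  accepting pairs of a dart and the aliased decoding `u ↦ accPairs[u mod |accPairs|]` of `[W²]`, which
  reaches every accepting pair, and decodes EVERY label to an accepting pair as soon as the dart has
  one (`dartProj_aliasDec_isSome`).
* `dartGame_valLe` — **soundness**: if every assignment with values `< W` violates at least `ε · n d`
  darts, then `val ≤ 1 - ε/2` ("for any `i ∈ S` there must be at least one `j ∈ [q]` such that the
  constraint `ψ_{i,j}` is violated": a violated dart has at most one of its two edges satisfied).
* `dartGame_spectral` — **expansion**: if `λ(G) ≤ λ` (`SpectralBound G.walkMatrix λ`), the game is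
  `(1 - λ)/2`-expanding in the sense of Dinur–Steurer §2.4 (`ProjGame.Spectral`): the random walk of
  the symmetrized game on the darts is dart → uniform endpoint → uniform dart at that vertex, i.e.
  `A_sym = P* P` for the averaging operator `P : ℓ²(darts) → ℓ²(vertices)`, and
  `P P* = (Id + A_G)/2`; hence `‖P g‖² ≤ (1 + λ)/2 · ‖g‖²` for `g ⊥ 1` (`sum_sq_dartOut_add_dartIn_le`,
  by Cauchy–Schwarz `‖P g‖⁴ = ⟨g, P* P g⟩² ≤ ‖g‖² ‖P*(P g)‖²` and
  `‖P* x‖² = ½ ‖x‖² + ½ ⟨x, A_G x⟩ ≤ ½ (1 + λ) ‖x‖²`, `dotProduct_mulVec_le`).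
* `dartGame_pow_valLe`, `dartGame_pow_sat` — **parallel repetition of the dart game**: with
  Dinur–Steurer Thm. 3.4 (`lamLe_of_spectral`) and Thm. 3.2 iterated (`valLe_pow`),
  `val((dartGame)^{⊗k}) ≤ (1 - ε_DS)^{k/2}` with `ε_DS = dsEps ((1-λ)/2) (ε/2) > 0`, while satisfiable
  instances stay satisfiable (`sat_pow`).

This is the analytic input "`labelcover(1, 1 - ε)` is NP-hard for some constant `ε > 0` … we can
assume wlog that `G` is expanding" of Dinur–Steurer §3.3, obtained here not through their Claim 8.1
but from the regular expanding constraint graphs that Dinur's preprocessing (`Expanderize.lean`,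
`DegreeReductionSoundness.lean`, explicit expanders `ExpanderFamily.lean`) produces; what remains
for `∀ ε > 0, ∃ W, (gapLabelCover W ε).IsNPHard` (`LabelCover.lean`) is the list-level rendering of
`(dartGame)^{⊗k}` as a regular `LabelCoverInstance`, its polynomial-time machine, and an NP-hard
family of regular expanding constraint graphs (the PCP theorem, `GapAssembly.lean`).

## References

* S. Arora, B. Barak, *Computational Complexity: A Modern Approach*, CUP 2009: Claim 22.36 and its
  proof (p. 495–496), Exercise 22.9 (projection property), Def. 21.2 and Lemma 21.3 (`λ(G)`),
  Thm. 22.15.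
* I. Dinur, D. Steurer, *Analytical approach to parallel repetition*, STOC 2014; arXiv:1305.1979:
  §2.4 (expanding games), Thm. 3.2, Thm. 3.4, §3.3 (hardness of label cover), Claim 8.1.
-/

namespace Literature.Computability.Complexity

open Finset Matrix

namespace Expander

namespace RotGraph

variable {n d : ℕ} (G : RotGraph n d) (C : Fin n → Fin d → ℕ → ℕ → Bool) (W : ℕ)
variable {β : Type} (dec : Fin n × Fin d → β → Fin W × Fin W)

/-! ### Dart sums: out of and into a vertex -/

/-- `∑_i g(u, i)`: the sum of a dart function over the darts out of `u`. [folklore] -/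
def dartOut (g : Fin n × Fin d → ℝ) (u : Fin n) : ℝ := ∑ i, g (u, i)

/-- `∑_i g(rot(u, i))`: the sum of a dart function over the darts into `u` (the reverses of the darts
out of `u`). [folklore] -/
def dartIn (g : Fin n × Fin d → ℝ) (u : Fin n) : ℝ := ∑ i, g (G.rot (u, i))

omit G in
/-- `∑_u dartOut g u = ∑_δ g δ`. [folklore] -/
theorem sum_dartOut (g : Fin n × Fin d → ℝ) : ∑ u, dartOut g u = ∑ δ, g δ := by
  unfold dartOut
  rw [Fintype.sum_prod_type]

/-- `∑_u dartIn g u = ∑_δ g δ` (dart reindexing by the rotation map). [folklore] -/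
theorem sum_dartIn (g : Fin n × Fin d → ℝ) : ∑ u, G.dartIn g u = ∑ δ, g δ := by
  unfold dartIn
  rw [← G.sum_rot g, Fintype.sum_prod_type]

omit G in
/-- The darts with tail `u`: `∑_δ [δ.1 = u] g δ = dartOut g u`. [folklore] -/
theorem sum_ite_tail (g : Fin n × Fin d → ℝ) (u : Fin n) :
    (∑ δ : Fin n × Fin d, if δ.1 = u then g δ else 0) = dartOut g u := by
  rw [Fintype.sum_prod_type, Fintype.sum_eq_single u fun v hv => ?_]
  · simp [dartOut]
  · simp [hv]

/-- The darts with head `u`: `∑_δ [nbr δ = u] g δ = dartIn g u`. [folklore] -/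
theorem sum_ite_head (g : Fin n × Fin d → ℝ) (u : Fin n) :
    (∑ δ : Fin n × Fin d, if G.nbr δ.1 δ.2 = u then g δ else 0) = G.dartIn g u := by
  rw [← G.sum_rot fun δ => if G.nbr δ.1 δ.2 = u then g δ else 0]
  have h : ∀ δ : Fin n × Fin d, (if G.nbr (G.rot δ).1 (G.rot δ).2 = u then g (G.rot δ) else 0) =
      if δ.1 = u then g (G.rot δ) else 0 := fun δ => by
    obtain ⟨v, i⟩ := δ
    rw [G.rot_apply, G.nbr_rlab]
  simp_rw [h]
  rw [Fintype.sum_prod_type, Fintype.sum_eq_single u fun v hv => ?_]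
  · simp [dartIn]
  · simp [hv]

/-- `dartOut` of a constant. [folklore] -/
theorem dartOut_const (c : ℝ) (u : Fin n) : dartOut (fun _ : Fin n × Fin d => c) u = d * c := by
  simp [dartOut]

/-- `dartIn` of a constant. [folklore] -/
theorem dartIn_const (c : ℝ) (u : Fin n) : G.dartIn (fun _ : Fin n × Fin d => c) u = d * c := by
  simp [dartIn]

omit G in
/-- `dartOut` is additive. [folklore] -/
theorem dartOut_add (g h : Fin n × Fin d → ℝ) (u : Fin n) : dartOut (fun δ => g δ + h δ) u = dartOut g u + dartOut h u := by
  simp [dartOut, sum_add_distrib]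

/-- `dartIn` is additive. [folklore] -/
theorem dartIn_add (g h : Fin n × Fin d → ℝ) (u : Fin n) : G.dartIn (fun δ => g δ + h δ) u = G.dartIn g u + G.dartIn h u := by
  simp [dartIn, sum_add_distrib]

/-! ### The key inequality: `‖P g‖² ≤ (1 + λ)/2 · ‖g‖²` on mean-zero dart functions -/

/-- **Expansion of the dart–vertex incidence walk.**  For a dart function `g` with `∑ g = 0` on a
`d`-regular graph with `λ(G) ≤ λ`:  `∑_u (∑_{darts at u} g)² ≤ 2 d (1 + λ) ∑_δ g(δ)²`, i.e.
`‖P g‖² ≤ (1+λ)/2 ‖g‖²` for the averaging operator `P` from darts to vertices (normalised measures).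
Proof: with `x u = ∑_{darts at u} g`, `∑_u x_u² = ∑_δ g_δ (x_{tail δ} + x_{head δ})` (this is
`⟨P g, P g⟩ = ⟨g, P* P g⟩`), Cauchy–Schwarz, and
`∑_δ (x_{tail δ} + x_{head δ})² = 2 d ∑ x² + 2 d ⟨x, A_G x⟩ ≤ 2 d (1 + λ) ∑ x²` (`x ⊥ 1`,
`dotProduct_mulVec_le`). [cite: AroraBarakCC2009, Def. 21.2 and Lemma 21.3 (λ(G) and the Rayleigh quotient on 1^⊥)] -/
theorem sum_sq_dartOut_add_dartIn_le (hd : 0 < d) {lam : ℝ} (hlam : SpectralBound G.walkMatrix lam)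
    (g : Fin n × Fin d → ℝ) (hg : ∑ δ, g δ = 0) :
    ∑ u, (dartOut g u + G.dartIn g u) ^ 2 ≤ 2 * d * (1 + lam) * ∑ δ, g δ ^ 2 := by
  set x : Fin n → ℝ := fun u => dartOut g u + G.dartIn g u with hx
  have hdR : (0 : ℝ) < d := by exact_mod_cast hd
  -- `x ⊥ 1`
  have hx0 : ∑ u, x u = 0 := by
    simp only [hx, sum_add_distrib, sum_dartOut, G.sum_dartIn, hg, add_zero]
  -- `∑ x² = ∑_δ g δ (x tail + x head)`
  set y : Fin n × Fin d → ℝ := fun δ => x δ.1 + x (G.nbr δ.1 δ.2) with hy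
  have h1 : ∑ u, x u ^ 2 = ∑ δ, g δ * y δ := by
    have hout : ∑ u, x u * dartOut g u = ∑ δ : Fin n × Fin d, x δ.1 * g δ := by
      simp only [dartOut, mul_sum]
      rw [Fintype.sum_prod_type]
    have hin : ∑ u, x u * G.dartIn g u = ∑ δ : Fin n × Fin d, x (G.nbr δ.1 δ.2) * g δ := by
      simp only [dartIn, mul_sum]
      rw [← Fintype.sum_prod_type (f := fun δ : Fin n × Fin d => x δ.1 * g (G.rot δ))]
      rw [← G.sum_rot fun δ => x (G.nbr δ.1 δ.2) * g δ]
      refine sum_congr rfl fun δ _ => ?_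
      obtain ⟨v, i⟩ := δ
      rw [G.rot_apply, G.nbr_rlab]
    calc ∑ u, x u ^ 2 = ∑ u, (x u * dartOut g u + x u * G.dartIn g u) := sum_congr rfl fun u _ => by rw [hx]; ring
      _ = ∑ δ : Fin n × Fin d, x δ.1 * g δ + ∑ δ : Fin n × Fin d, x (G.nbr δ.1 δ.2) * g δ := by
          rw [sum_add_distrib, hout, hin]
      _ = ∑ δ, g δ * y δ := by rw [← sum_add_distrib]; exact sum_congr rfl fun δ _ => by rw [hy]; ring
  -- Cauchy–Schwarz
  have h2 : (∑ δ, g δ * y δ) ^ 2 ≤ (∑ δ, g δ ^ 2) * ∑ δ, y δ ^ 2 := sum_mul_sq_le_sq_mul_sq univ g y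
  -- `∑ y² = 2d ∑ x² + 2d ⟨x, A x⟩ ≤ 2 d (1 + λ) ∑ x²`
  have hAx : ∀ u, ∑ i, x (G.nbr u i) = d * (G.walkMatrix *ᵥ x) u := fun u => by
    rw [G.walkMatrix_mulVec, mul_div_cancel₀ _ hdR.ne']
  have h3 : ∑ δ, y δ ^ 2 = 2 * d * ∑ u, x u ^ 2 + 2 * d * (x ⬝ᵥ (G.walkMatrix *ᵥ x)) := by
    have hsq : ∀ δ : Fin n × Fin d, y δ ^ 2 = x δ.1 ^ 2 + x (G.nbr δ.1 δ.2) ^ 2 + 2 * (x δ.1 * x (G.nbr δ.1 δ.2)) :=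
      fun δ => by rw [hy]; ring
    simp_rw [hsq]
    rw [sum_add_distrib, sum_add_distrib, Fintype.sum_prod_type, Fintype.sum_prod_type, Fintype.sum_prod_type]
    simp only
    have ha : ∑ u : Fin n, ∑ _i : Fin d, x u ^ 2 = d * ∑ u, x u ^ 2 := by
      simp only [sum_const, card_univ, Fintype.card_fin, nsmul_eq_mul, mul_sum]
    have hb : ∑ u : Fin n, ∑ i : Fin d, x (G.nbr u i) ^ 2 = d * ∑ u, x u ^ 2 := by
      rw [G.sum_sum_nbr fun u => x u ^ 2, nsmul_eq_mul]
    have hc : ∑ u : Fin n, ∑ i : Fin d, 2 * (x u * x (G.nbr u i)) = 2 * d * (x ⬝ᵥ (G.walkMatrix *ᵥ x)) := by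
      have h : ∀ u, ∑ i : Fin d, 2 * (x u * x (G.nbr u i)) = 2 * d * (x u * (G.walkMatrix *ᵥ x) u) := fun u => by
        rw [← mul_sum, ← mul_sum, hAx u]; ring
      simp_rw [h]
      rw [← mul_sum]
      simp only [dotProduct]
    rw [ha, hb, hc]
    ring
  have h4 : ∑ δ, y δ ^ 2 ≤ 2 * d * (1 + lam) * ∑ u, x u ^ 2 := by
    rw [h3]
    have hR := dotProduct_mulVec_le hlam x hx0
    have hxx : x ⬝ᵥ x = ∑ u, x u ^ 2 := by simp only [dotProduct, sq]
    rw [hxx] at hR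
    nlinarith [hdR.le, hR]
  -- conclude
  have hS : 0 ≤ ∑ u, x u ^ 2 := sum_nonneg fun u _ => sq_nonneg _
  have hQ : 0 ≤ ∑ δ, g δ ^ 2 := sum_nonneg fun δ _ => sq_nonneg _
  have hl0 : 0 ≤ 2 * d * (1 + lam) := by have := hlam.1; positivity
  have key : (∑ u, x u ^ 2) ^ 2 ≤ (∑ δ, g δ ^ 2) * (2 * d * (1 + lam) * ∑ u, x u ^ 2) := by
    calc (∑ u, x u ^ 2) ^ 2 = (∑ δ, g δ * y δ) ^ 2 := by rw [h1]
      _ ≤ (∑ δ, g δ ^ 2) * ∑ δ, y δ ^ 2 := h2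
      _ ≤ (∑ δ, g δ ^ 2) * (2 * d * (1 + lam) * ∑ u, x u ^ 2) := mul_le_mul_of_nonneg_left h4 hQ
  change ∑ u, x u ^ 2 ≤ 2 * d * (1 + lam) * ∑ δ, g δ ^ 2
  rcases hS.eq_or_lt with hS0 | hSpos
  · rw [← hS0]; exact mul_nonneg hl0 hQ
  · have : (∑ u, x u ^ 2) * (∑ u, x u ^ 2) ≤ (2 * d * (1 + lam) * ∑ δ, g δ ^ 2) * ∑ u, x u ^ 2 := by
      rw [← sq]; linarith [key]
    exact le_of_mul_le_mul_right this hSpos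

/-! ### The dart game -/

/-- Alice's endpoint of the edge `(δ, s)`: the tail of the dart for `s = 0`, its head for `s = 1`.
[cite: AroraBarakCC2009, Claim 22.36 (proof: the constraints ψ_{i,j}(y_i, u_j), j ∈ [q])] -/
def dartEnd (e : (Fin n × Fin d) × Fin 2) : Fin n := if e.2 = 0 then e.1.1 else G.nbr e.1.1 e.1.2

omit G in
/-- The projection of the edge `(δ, s)`: Bob's label, decoding to `(a, b)`, is sent to `a` (`s = 0`) or
`b` (`s = 1`) if `(a, b)` satisfies the dart constraint, and is rejected otherwise ("`ψ_{i,j}(y_i, u_j)`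
is true iff `y_i` encodes an assignment … satisfying `φ_i` and `u_j` … agrees with the assignment `y_i`").
[cite: AroraBarakCC2009, Claim 22.36 (proof) and Exercise 22.9] -/
def dartProj (e : (Fin n × Fin d) × Fin 2) (b : β) : Option (Fin W) :=
  if C e.1.1 e.1.2 (dec e.1 b).1 (dec e.1 b).2 = true then some (if e.2 = 0 then (dec e.1 b).1 else (dec e.1 b).2) else none

/-- **The projection game of a regular constraint graph** (`d ≥ 1`): Bob = darts with labels `β`
decoded by `dec` into `[W]²`, Alice = vertices with labels `[W]`, two unit-weight edges per dart.
[cite: AroraBarakCC2009, Claim 22.36 and Exercise 22.9] -/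
def dartGame (hd : 0 < d) : ProjGame ((Fin n × Fin d) × Fin 2) (Fin n × Fin d) (Fin n) β (Fin W) where
  src e := e.1
  dst := G.dartEnd
  proj := dartProj C W dec
  wt _ := 1
  wt_pos _ := one_pos
  src_surj δ := ⟨(δ, 0), rfl⟩
  dst_surj u := ⟨((u, ⟨0, hd⟩), 0), by simp [dartEnd]⟩

variable (hd : 0 < d)

/-- `src` of the dart game (definitional). [folklore] -/
@[simp] theorem dartGame_src (e : (Fin n × Fin d) × Fin 2) : (G.dartGame C W dec hd).src e = e.1 := rfl

/-- `dst` of the dart game (definitional). [folklore] -/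
@[simp] theorem dartGame_dst (e : (Fin n × Fin d) × Fin 2) : (G.dartGame C W dec hd).dst e = G.dartEnd e := rfl

/-- `proj` of the dart game (definitional). [folklore] -/
@[simp] theorem dartGame_proj (e : (Fin n × Fin d) × Fin 2) : (G.dartGame C W dec hd).proj e = dartProj C W dec e := rfl

/-- The dart game has unit weights (definitional). [folklore] -/
@[simp] theorem dartGame_wt (e : (Fin n × Fin d) × Fin 2) : (G.dartGame C W dec hd).wt e = 1 := rfl

omit G in
/-- Sums over the edges of the dart game: `∑_e F e = ∑_δ (F (δ, 0) + F (δ, 1))`. [folklore] -/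
theorem sum_dartEdge (F : (Fin n × Fin d) × Fin 2 → ℝ) : ∑ e, F e = ∑ δ, (F (δ, 0) + F (δ, 1)) := by
  rw [Fintype.sum_prod_type]
  exact sum_congr rfl fun δ _ => Fin.sum_univ_two _

/-- **The fibre sums of the dart game**: the darts at Alice's vertex `u` are the darts out of `u`
(through their `s = 0` edge) and the darts into `u` (through `s = 1`). [folklore] -/
theorem sum_ite_dartEnd (g : Fin n × Fin d → ℝ) (u : Fin n) :
    (∑ e : (Fin n × Fin d) × Fin 2, if G.dartEnd e = u then g e.1 else 0) = dartOut g u + G.dartIn g u := by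
  rw [sum_dartEdge, sum_add_distrib]
  have h0 : ∀ δ : Fin n × Fin d, G.dartEnd (δ, 0) = δ.1 := fun δ => rfl
  have h1 : ∀ δ : Fin n × Fin d, G.dartEnd (δ, 1) = G.nbr δ.1 δ.2 := fun δ => rfl
  simp_rw [h0, h1]
  rw [sum_ite_tail, G.sum_ite_head]

/-- The total weight of the dart game is `2 n d`. [cite: AroraBarakCC2009, Claim 22.36 ("the number of constraints in ψ is qm")] -/
theorem total_dartGame : (G.dartGame C W dec hd).total = 2 * n * d := by
  unfold ProjGame.total
  simp only [dartGame_wt, sum_const, card_univ, Fintype.card_prod, Fintype.card_fin, nsmul_eq_mul, mul_one]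
  push_cast
  ring

/-- Every vertex of Alice has weight `2 d` (bi-regularity on Alice's side). [folklore] -/
theorem wU_dartGame (u : Fin n) : (G.dartGame C W dec hd).wU u = 2 * d := by
  unfold ProjGame.wU
  simp only [dartGame_dst, dartGame_wt]
  have h := G.sum_ite_dartEnd (fun _ => (1 : ℝ)) u
  rw [dartOut_const, G.dartIn_const] at h
  rw [h]
  ring

/-- Every vertex of Bob (dart) has weight `2` (bi-regularity on Bob's side). [folklore] -/
theorem wV_dartGame (δ : Fin n × Fin d) : (G.dartGame C W dec hd).wV δ = 2 := by
  unfold ProjGame.wV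
  simp only [dartGame_src, dartGame_wt]
  rw [sum_dartEdge]
  simp only
  rw [sum_add_distrib]
  simp only [sum_ite_eq', mem_univ, if_true]
  norm_num

/-! ### Decodings: the plain alphabet `[W]²` and the aliased alphabet `[W²]` -/

omit G in
/-- The accepting pairs of the dart `(v, i)`, in lexicographic order. [cite: AroraBarakCC2009, Claim 22.36 (proof: "y_i encodes an assignment … satisfying φ_i")] -/
def accPairs (v : Fin n) (i : Fin d) : List (Fin W × Fin W) :=
  ((List.finRange W) ×ˢ (List.finRange W)).filter fun p => C v i p.1 p.2

omit G in
/-- Membership in `accPairs` is acceptance. [folklore] -/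
theorem mem_accPairs {v : Fin n} {i : Fin d} {p : Fin W × Fin W} : p ∈ accPairs C W v i ↔ C v i p.1 p.2 = true := by
  obtain ⟨a, b⟩ := p
  simp [accPairs, List.mem_filter, List.mem_finRange]

omit G in
/-- `|accPairs| ≤ W²`. [folklore] -/
theorem length_accPairs_le (v : Fin n) (i : Fin d) : (accPairs C W v i).length ≤ W * W :=
  (List.length_filter_le _ _).trans (by rw [List.length_product, List.length_finRange])

omit G in
/-- **The aliased decoding** of the alphabet `[W²]` at the dart `δ`: `u ↦ accPairs[u mod |accPairs|]`, so that
every label decodes to an accepting pair when there is one (and to `(0, 0)` otherwise). [folklore] -/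
def aliasDec (δ : Fin n × Fin d) (u : Fin (W * W)) : Fin W × Fin W :=
  if h : 0 < (accPairs C W δ.1 δ.2).length then
    (accPairs C W δ.1 δ.2)[u.val % (accPairs C W δ.1 δ.2).length]'(Nat.mod_lt _ h)
  else
    have hW : 0 < W := Nat.pos_of_ne_zero fun h0 => Nat.lt_irrefl 0 (by simpa [h0] using u.pos)
    (⟨0, hW⟩, ⟨0, hW⟩)

omit G in
/-- An aliased label of a dart with an accepting pair decodes to an accepting pair. [folklore] -/
theorem aliasDec_mem {δ : Fin n × Fin d} (h : 0 < (accPairs C W δ.1 δ.2).length) (u : Fin (W * W)) :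
    aliasDec C W δ u ∈ accPairs C W δ.1 δ.2 := by
  unfold aliasDec
  rw [dif_pos h]
  exact List.getElem_mem _

omit G in
/-- Hence its constraint holds. [folklore] -/
theorem accept_aliasDec {δ : Fin n × Fin d} (h : 0 < (accPairs C W δ.1 δ.2).length) (u : Fin (W * W)) :
    C δ.1 δ.2 (aliasDec C W δ u).1 (aliasDec C W δ u).2 = true :=
  (mem_accPairs C W).1 (aliasDec_mem C W h u)

omit G in
/-- **The aliased decoding reaches every accepting pair** (the hypothesis `hdec` of `dartGame_sat`). [folklore] -/
theorem exists_aliasDec_eq (δ : Fin n × Fin d) (p : Fin W × Fin W) (hp : C δ.1 δ.2 p.1 p.2 = true) :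
    ∃ u : Fin (W * W), aliasDec C W δ u = p := by
  have hmem : p ∈ accPairs C W δ.1 δ.2 := (mem_accPairs C W).2 hp
  obtain ⟨j, hj, hjp⟩ := List.mem_iff_getElem.1 hmem
  have hlen : 0 < (accPairs C W δ.1 δ.2).length := lt_of_le_of_lt (Nat.zero_le _) hj
  refine ⟨⟨j, lt_of_lt_of_le hj (length_accPairs_le C W δ.1 δ.2)⟩, ?_⟩
  unfold aliasDec
  rw [dif_pos hlen]
  simp only [Nat.mod_eq_of_lt hj]
  exact hjp

omit G in
/-- The plain decoding `[W]² → [W]²` reaches every (accepting) pair. [folklore] -/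
theorem exists_id_eq (δ : Fin n × Fin d) (p : Fin W × Fin W) (_hp : C δ.1 δ.2 p.1 p.2 = true) :
    ∃ b : Fin W × Fin W, (fun (_ : Fin n × Fin d) (b : Fin W × Fin W) => b) δ b = p :=
  ⟨p, rfl⟩

/-- **Totality of the aliased dart game**: if every dart has an accepting pair, every label is projected
(never rejected) — the form required by the list format `LabelCoverConstraint.proj : [W] → [W]` of
`LabelCover.lean`. [cite: AroraBarakCC2009, §22.3 (projection property: a function h : [W] → [W])] -/
theorem dartProj_aliasDec_isSome (h : ∀ v i, 0 < (accPairs C W v i).length) (e : (Fin n × Fin d) × Fin 2) (u : Fin (W * W)) :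
    (dartProj C W (aliasDec C W) e u).isSome = true := by
  unfold dartProj
  rw [accept_aliasDec C W (h e.1.1 e.1.2) u, if_pos rfl]
  rfl

/-! ### Completeness and soundness -/

/-- **Completeness**: an assignment with values `< W` satisfying every dart constraint gives
strategies satisfying every edge of the dart game. [cite: AroraBarakCC2009, Claim 22.36 ("Clearly, if φ is satisfiable, then so is ψ")] -/
theorem dartGame_sat (hdec : ∀ (δ : Fin n × Fin d) (p : Fin W × Fin W), C δ.1 δ.2 p.1 p.2 = true → ∃ b, dec δ b = p)
    {σ : Fin n → ℕ} (hσ : ∀ u, σ u < W) (hsat : ∀ v i, C v i (σ v) (σ (G.nbr v i)) = true) :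
    ∃ (b : Fin n × Fin d → β) (a : Fin n → Fin W),
      ∀ e, (G.dartGame C W dec hd).proj e (b ((G.dartGame C W dec hd).src e)) = some (a ((G.dartGame C W dec hd).dst e)) := by
  have hex : ∀ δ : Fin n × Fin d, ∃ b, dec δ b = (⟨σ δ.1, hσ _⟩, ⟨σ (G.nbr δ.1 δ.2), hσ _⟩) :=
    fun δ => hdec δ _ (hsat δ.1 δ.2)
  choose b hb using hex
  refine ⟨b, fun u => ⟨σ u, hσ u⟩, fun e => ?_⟩
  obtain ⟨⟨v, i⟩, s⟩ := e
  simp only [dartGame_proj, dartGame_src, dartGame_dst, dartProj, hb, hsat v i, if_true, dartEnd]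
  congr 1
  by_cases hs : s = 0
  · simp [hs]
  · simp [hs]

/-- The two edges of a dart whose constraint is violated by Alice's labels cannot both be satisfied. [cite: AroraBarakCC2009, Claim 22.36 (proof: "at least one j ∈ [q] such that ψ_{i,j} is violated")] -/
theorem dartGame_edges_le_one {b : Fin n × Fin d → β} {a : Fin n → Fin W} (δ : Fin n × Fin d)
    (hviol : C δ.1 δ.2 (a δ.1) (a (G.nbr δ.1 δ.2)) = false) :
    ((if dartProj C W dec (δ, 0) (b δ) = some (a (G.dartEnd (δ, 0))) then (1 : ℝ) else 0) +
      if dartProj C W dec (δ, 1) (b δ) = some (a (G.dartEnd (δ, 1))) then (1 : ℝ) else 0) ≤ 1 := by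
  have h0 : G.dartEnd (δ, 0) = δ.1 := rfl
  have h1 : G.dartEnd (δ, 1) = G.nbr δ.1 δ.2 := rfl
  rw [h0, h1]
  by_cases hC : C δ.1 δ.2 (dec δ (b δ)).1 (dec δ (b δ)).2 = true
  · -- both satisfied would force `dec δ (b δ) = (a tail, a head)`, contradicting `hviol`
    have hnot : ¬ (dartProj C W dec (δ, 0) (b δ) = some (a δ.1) ∧ dartProj C W dec (δ, 1) (b δ) = some (a (G.nbr δ.1 δ.2))) := by
      rintro ⟨ha, hb⟩
      simp only [dartProj, hC, if_true, Option.some.injEq] at ha hb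
      simp only [Fin.isValue, ↓reduceIte, one_ne_zero] at ha hb
      rw [← ha, ← hb] at hviol
      rw [hviol] at hC
      exact Bool.false_ne_true hC
    by_cases hx : dartProj C W dec (δ, 0) (b δ) = some (a δ.1)
    · by_cases hy : dartProj C W dec (δ, 1) (b δ) = some (a (G.nbr δ.1 δ.2))
      · exact absurd ⟨hx, hy⟩ hnot
      · rw [if_pos hx, if_neg hy]; norm_num
    · rw [if_neg hx]; split_ifs <;> norm_num
  · have hnone : ∀ s : Fin 2, dartProj C W dec (δ, s) (b δ) = none := fun s => by
      simp [dartProj, hC]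
    simp [hnone]

/-- **Soundness**: if every assignment with values `< W` violates at least `ε · n d` darts of `(G, C)`,
then `val(dartGame) ≤ 1 - ε/2`. [cite: AroraBarakCC2009, Claim 22.36 (val(φ) ≤ 1 - ε ⇒ val(ψ) ≤ 1 - ε/q)] -/
theorem dartGame_valLe {ε : ℝ}
    (hε : ∀ σ : Fin n → ℕ, (∀ u, σ u < W) →
      ε * (n * d) ≤ ((univ.filter fun x : Fin n × Fin d => C x.1 x.2 (σ x.1) (σ (G.nbr x.1 x.2)) = false).card : ℝ)) :
    (G.dartGame C W dec hd).ValLe (1 - ε / 2) := by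
  intro b a
  rw [total_dartGame]
  set Bad := univ.filter fun x : Fin n × Fin d => C x.1 x.2 (a x.1 : ℕ) (a (G.nbr x.1 x.2) : ℕ) = false with hBad
  have hB : ε * (n * d) ≤ (Bad.card : ℝ) := hε (fun u => (a u : ℕ)) fun u => (a u).isLt
  -- per-dart bound
  have hper : ∀ δ : Fin n × Fin d,
      ((if dartProj C W dec (δ, 0) (b δ) = some (a (G.dartEnd (δ, 0))) then (1 : ℝ) else 0) +
        if dartProj C W dec (δ, 1) (b δ) = some (a (G.dartEnd (δ, 1))) then (1 : ℝ) else 0) ≤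
        2 - if δ ∈ Bad then (1 : ℝ) else 0 := fun δ => by
    by_cases hδ : δ ∈ Bad
    · rw [if_pos hδ]
      have hviol : C δ.1 δ.2 (a δ.1 : ℕ) (a (G.nbr δ.1 δ.2) : ℕ) = false := (mem_filter.1 hδ).2
      have := G.dartGame_edges_le_one C W dec (b := b) (a := a) δ hviol
      linarith
    · rw [if_neg hδ]
      have : ∀ p q : Prop, ∀ [Decidable p] [Decidable q], ((if p then (1 : ℝ) else 0) + if q then (1 : ℝ) else 0) ≤ 2 - 0 := by
        intro p q _ _; split_ifs <;> norm_num
      exact this _ _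
  unfold ProjGame.satW
  simp only [dartGame_proj, dartGame_src, dartGame_dst, dartGame_wt]
  rw [sum_dartEdge]
  calc ∑ δ : Fin n × Fin d, ((if dartProj C W dec (δ, 0) (b δ) = some (a (G.dartEnd (δ, 0))) then (1 : ℝ) else 0) +
          if dartProj C W dec (δ, 1) (b δ) = some (a (G.dartEnd (δ, 1))) then (1 : ℝ) else 0)
        ≤ ∑ δ : Fin n × Fin d, (2 - if δ ∈ Bad then (1 : ℝ) else 0) := sum_le_sum fun δ _ => hper δ
    _ = 2 * (n * d) - Bad.card := by
        rw [sum_sub_distrib, sum_const, card_univ, Fintype.card_prod, Fintype.card_fin, Fintype.card_fin,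
          nsmul_eq_mul, sum_ite_mem, univ_inter, sum_const, nsmul_eq_mul, mul_one]
        push_cast
        ring
    _ ≤ 2 * (n * d) - ε * (n * d) := by linarith
    _ = (1 - ε / 2) * (2 * n * d) := by ring

/-! ### Expansion -/

/-- The quadratic form of the symmetrized dart game: `⟨g, A_sym g⟩ = ∑_u (∑_{darts at u} g)² / (4 n d²)`.
[cite: DinurSteurer2014, §2.4] -/
theorem symForm_dartGame (g : Fin n × Fin d → ℝ) :
    (G.dartGame C W dec hd).symForm g = ∑ u, (dartOut g u + G.dartIn g u) ^ 2 / (2 * n * d * (2 * d)) := by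
  unfold ProjGame.symForm
  refine sum_congr rfl fun u _ => ?_
  rw [total_dartGame, wU_dartGame]
  simp only [dartGame_dst, dartGame_wt, dartGame_src, one_mul]
  rw [G.sum_ite_dartEnd]

/-- `‖g‖² = 𝔼_δ g(δ)² = (∑_δ g δ²) / (n d)` in the dart game. [cite: DinurSteurer2014, §2.1] -/
theorem normVE_dartGame (g : Fin n × Fin d → ℝ) :
    (G.dartGame C W dec hd).normVE g = (∑ δ, g δ ^ 2) / (n * d) := by
  unfold ProjGame.normVE
  rw [total_dartGame]
  simp only [dartGame_wt, dartGame_src, one_mul]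
  rw [sum_dartEdge]
  simp only
  have hdR : (0 : ℝ) < d := by exact_mod_cast hd
  rcases Nat.eq_zero_or_pos n with hn | hn
  · subst hn; simp
  · have hnR : (0 : ℝ) < n := by exact_mod_cast hn
    have h2 : ∀ x : Fin n × Fin d, g x ^ 2 + g x ^ 2 = 2 * g x ^ 2 := fun x => by ring
    simp_rw [h2]
    rw [← mul_sum, div_eq_div_iff (by positivity) (by positivity)]
    ring

/-- `ḡ = 𝔼_δ g(δ) = (∑_δ g δ) / (n d)` in the dart game. [cite: DinurSteurer2014, Thm. 3.4 (proof, f̄)] -/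
theorem meanE_dartGame (g : Fin n × Fin d → ℝ) :
    (G.dartGame C W dec hd).meanE g = (∑ δ, g δ) / (n * d) := by
  unfold ProjGame.meanE
  rw [total_dartGame]
  simp only [dartGame_wt, dartGame_src, one_mul]
  rw [sum_dartEdge]
  simp only
  have hdR : (0 : ℝ) < d := by exact_mod_cast hd
  rcases Nat.eq_zero_or_pos n with hn | hn
  · subst hn; simp
  · have hnR : (0 : ℝ) < n := by exact_mod_cast hn
    have h2 : ∀ x : Fin n × Fin d, g x + g x = 2 * g x := fun x => by ring
    simp_rw [h2]
    rw [← mul_sum, div_eq_div_iff (by positivity) (by positivity)]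
    ring

/-- **The dart game of a `λ`-spectral-expander is `(1 - λ)/2`-expanding** (Dinur–Steurer §2.4):
`⟨g, A_sym g⟩ ≤ (1+λ)/2 · ‖g‖² + (1-λ)/2 · ḡ²` for every dart function `g`.  Reduce to `ḡ = 0` by
subtracting the mean (the symmetrized walk fixes constants) and apply `sum_sq_dartOut_add_dartIn_le`.
[cite: DinurSteurer2014, §2.4 (γ-expanding games); AroraBarakCC2009, Def. 21.2] -/
theorem dartGame_spectral (hn : 0 < n) {lam : ℝ} (hlam : SpectralBound G.walkMatrix lam) :
    (G.dartGame C W dec hd).Spectral ((1 - lam) / 2) := by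
  intro g
  have hdR : (0 : ℝ) < d := by exact_mod_cast hd
  have hnR : (0 : ℝ) < n := by exact_mod_cast hn
  have hN : (0 : ℝ) < n * d := mul_pos hnR hdR
  rw [symForm_dartGame, normVE_dartGame, meanE_dartGame]
  set T := ∑ δ, g δ with hT
  set Q := ∑ δ, g δ ^ 2 with hQ
  set m := T / (n * d) with hm
  -- the mean-zero part
  set g₀ : Fin n × Fin d → ℝ := fun δ => g δ + -m with hg₀
  have hg₀0 : ∑ δ, g₀ δ = 0 := by
    simp only [hg₀, sum_add_distrib, sum_const, card_univ, Fintype.card_prod, Fintype.card_fin, smul_neg, nsmul_eq_mul]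
    rw [← hT, hm]
    push_cast
    field_simp
    ring
  have hQ₀ : ∑ δ, g₀ δ ^ 2 = Q - n * d * m ^ 2 := by
    have h : ∀ δ, g₀ δ ^ 2 = g δ ^ 2 - 2 * m * g δ + m ^ 2 := fun δ => by rw [hg₀]; ring
    simp_rw [h]
    rw [sum_add_distrib, sum_sub_distrib, ← mul_sum, ← hQ, ← hT, sum_const, card_univ, Fintype.card_prod,
      Fintype.card_fin, Fintype.card_fin, nsmul_eq_mul]
    have hTm : T = m * (n * d) := by rw [hm]; field_simp
    rw [hTm]
    push_cast
    ring
  -- decomposition of the fibre sums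
  set X : Fin n → ℝ := fun u => dartOut g₀ u + G.dartIn g₀ u with hX
  have hdecomp : ∀ u, dartOut g u + G.dartIn g u = X u + 2 * d * m := fun u => by
    have hg : g = fun δ => g₀ δ + m := by funext δ; simp [hg₀]
    rw [hX]
    simp only
    conv_lhs => rw [hg]
    rw [dartOut_add, G.dartIn_add, dartOut_const, G.dartIn_const]
    ring
  have hX0 : ∑ u, X u = 0 := by
    simp only [hX, sum_add_distrib, sum_dartOut, G.sum_dartIn, hg₀0, add_zero]
  have hsumsq : ∑ u, (dartOut g u + G.dartIn g u) ^ 2 = ∑ u, X u ^ 2 + n * (2 * d * m) ^ 2 := by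
    simp_rw [hdecomp]
    have h : ∀ u, (X u + 2 * d * m) ^ 2 = X u ^ 2 + 2 * (2 * d * m) * X u + (2 * d * m) ^ 2 := fun u => by ring
    simp_rw [h]
    rw [sum_add_distrib, sum_add_distrib, ← mul_sum, hX0, mul_zero, add_zero, sum_const, card_univ, Fintype.card_fin,
      nsmul_eq_mul]
  -- the key inequality on `g₀`
  have hkey : ∑ u, X u ^ 2 ≤ 2 * d * (1 + lam) * ∑ δ, g₀ δ ^ 2 := G.sum_sq_dartOut_add_dartIn_le hd hlam g₀ hg₀0
  rw [hQ₀] at hkey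
  rw [← sum_div, hsumsq, div_le_iff₀ (by positivity)]
  -- arithmetic: clear the remaining denominator `Q / (n d)`
  set q := Q / (n * d) with hq
  have hQq : Q = q * (n * d) := by rw [hq]; field_simp
  rw [hQq] at hkey
  have hl := hlam.1
  nlinarith [hkey, hl, sq_nonneg m, hnR, hdR]

/-! ### Parallel repetition of the dart game -/

omit G in
/-- The edge type of the dart game is nonempty for `n, d ≥ 1`. [folklore] -/
theorem nonempty_dartEdge (hn : 0 < n) (hd' : 0 < d) : Nonempty ((Fin n × Fin d) × Fin 2) :=
  ⟨((⟨0, hn⟩, ⟨0, hd'⟩), 0)⟩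

/-- **Value decay under parallel repetition for regular expanding constraint graphs.**  If `λ(G) ≤ λ < 1`
and every assignment with values `< W` violates at least `ε · n d` darts (`0 < ε ≤ 2`), then
`val(dartGame^{⊗k}) ≤ (√(1 - ε_DS))^k` with `ε_DS = dsEps ((1-λ)/2) (ε/2) > 0` — Dinur–Steurer
Thm. 3.4 for the `(1-λ)/2`-expanding dart game of value `≤ 1 - ε/2`, then Thm. 3.2 `k` times and
Claim 2.3. [cite: DinurSteurer2014, §3.3 (val(G^{⊗k}) ≤ ‖G^{⊗k}‖ ≤ λ₊(G)^k ≤ (1 - Ω(ε))^k)] -/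
theorem dartGame_pow_valLe [Fintype β] [DecidableEq β] (hn : 0 < n) {lam ε : ℝ} (hlam : SpectralBound G.walkMatrix lam) (hlam1 : lam < 1)
    (hε2 : ε ≤ 2)
    (hε : ∀ σ : Fin n → ℕ, (∀ u, σ u < W) →
      ε * (n * d) ≤ ((univ.filter fun x : Fin n × Fin d => C x.1 x.2 (σ x.1) (σ (G.nbr x.1 x.2)) = false).card : ℝ))
    (k : ℕ) :
    ((G.dartGame C W dec hd).pow k).ValLe (Real.sqrt (1 - ProjGame.dsEps ((1 - lam) / 2) (ε / 2)) ^ k) := by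
  haveI := nonempty_dartEdge hn hd
  have hγ : 0 < (1 - lam) / 2 := by linarith
  have hγ1 : (1 - lam) / 2 ≤ 1 := by linarith [hlam.1]
  have hval : (G.dartGame C W dec hd).ValLe (1 - ε / 2) := G.dartGame_valLe C W dec hd hε
  have hlamLe := (G.dartGame C W dec hd).lamLe_of_spectral hγ (by linarith) (G.dartGame_spectral C W dec hd hn hlam) hval
  have hc0 : 0 ≤ 1 - ProjGame.dsEps ((1 - lam) / 2) (ε / 2) := by linarith [ProjGame.dsEps_le_one (η := ε / 2) hγ1]
  exact (G.dartGame C W dec hd).valLe_pow hc0 hlamLe k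

/-- The decay base is `< 1` when moreover `ε > 0`. [cite: DinurSteurer2014, Thm. 3.4] -/
theorem sqrt_one_sub_dsEps_lt_one {lam ε : ℝ} (hlam1 : lam < 1) (hε : 0 < ε) :
    Real.sqrt (1 - ProjGame.dsEps ((1 - lam) / 2) (ε / 2)) < 1 := by
  have hpos : 0 < ProjGame.dsEps ((1 - lam) / 2) (ε / 2) := ProjGame.dsEps_pos (by linarith) (by linarith)
  rw [Real.sqrt_lt' one_pos]
  linarith

/-- **Completeness under parallel repetition**: a satisfying assignment of `(G, C)` with values `< W`
gives perfect strategies for every `dartGame^{⊗k}`. [cite: DinurSteurer2014, §3.3 ("if val(G) = 1 clearly val(G^{⊗k}) = 1")] -/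
theorem dartGame_pow_sat (hdec : ∀ (δ : Fin n × Fin d) (p : Fin W × Fin W), C δ.1 δ.2 p.1 p.2 = true → ∃ b, dec δ b = p)
    {σ : Fin n → ℕ} (hσ : ∀ u, σ u < W) (hsat : ∀ v i, C v i (σ v) (σ (G.nbr v i)) = true) (k : ℕ) :
    ∃ (bk : ProjGame.NProd (Fin n × Fin d) k → ProjGame.NProd β k)
      (ak : ProjGame.NProd (Fin n) k → ProjGame.NProd (Fin W) k),
      ∀ p, ((G.dartGame C W dec hd).pow k).proj p (bk (((G.dartGame C W dec hd).pow k).src p)) =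
        some (ak (((G.dartGame C W dec hd).pow k).dst p)) := by
  obtain ⟨b, a, h⟩ := G.dartGame_sat C W dec hd hdec hσ hsat
  exact (G.dartGame C W dec hd).sat_pow h k

/-- In particular the repeated game of a satisfiable instance has value `1`: some strategies satisfy
weight `total`. [cite: DinurSteurer2014, §3.3] -/
theorem dartGame_pow_satW_eq_total [Fintype β]
    (hdec : ∀ (δ : Fin n × Fin d) (p : Fin W × Fin W), C δ.1 δ.2 p.1 p.2 = true → ∃ b, dec δ b = p)
    {σ : Fin n → ℕ} (hσ : ∀ u, σ u < W) (hsat : ∀ v i, C v i (σ v) (σ (G.nbr v i)) = true) (k : ℕ) :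
    ∃ (bk : ProjGame.NProd (Fin n × Fin d) k → ProjGame.NProd β k)
      (ak : ProjGame.NProd (Fin n) k → ProjGame.NProd (Fin W) k),
      ((G.dartGame C W dec hd).pow k).satW bk ak = ((G.dartGame C W dec hd).pow k).total := by
  obtain ⟨bk, ak, h⟩ := G.dartGame_pow_sat C W dec hd hdec hσ hsat k
  exact ⟨bk, ak, ((G.dartGame C W dec hd).pow k).satW_eq_total_of_sat h⟩

end RotGraph

end Expander

end Literature.Computability.Complexity
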